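import Literature.Probability.RandomPlanarGeometry.HexSAWObservableRot
import Literature.Probability.RandomPlanarGeometry.HexSAWStrip
import HarnessLib

/-!
# The curtain lemma for the honeycomb strip: a walk from the bottom level to the top level cannot be by-passed

Topic `Literature/Probability/RandomPlanarGeometry` (uses only `HV.lev` of `HexSAWStrip.lean` and the column coordinate
`HV.xi (x₀,x₁,b) = 2x₀ + x₁ + b` of `HexSAWObservableRot.lean`).  Setting: H. Duminil-Copin, S. Smirnov, *The connective
constant of the honeycomb lattice equals √(2+√2)*, Ann. Math. 175 (2012), §3: the strip `S_T` of `ℍ` between the levels `0`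
and `2T − 1` (their domains `S_{T,L}` and the limit `L → ∞`); N. R. Beaton et al., CMP 326 (2014), §4 (the same strip with a
surface fugacity on the `β` side).  The lemma below is the planarity input of the lane's automaton-free route to the linear
upper law of the strip bridge partition function at its threshold (`MATHS-NOTE-k1-renewal.md`, module [J]): it lets one cut a
`β`-walk into a top-free initial piece, a Duminil-Copin–Hammond bridge in the horizontal direction, and a bottom-free final
piece.

## What is proved (namespace `Literature.Probability.RandomPlanarGeometry.SAW.HV`)

Coordinates: `eq_of_lev_eq_of_xi_eq` (level and column determine the vertex), `even_xi_sub_xi_of_lev_eq`,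
`xi_lt_xi_iff_of_adj` (for two edges between the same pair of consecutive levels, "left of" is the same at both levels).

★ **`curtain_lemma`**.  Let `K = (k₀, …, k_n)` be ANY lattice walk (consecutive vertices adjacent; self-intersections and
excursions outside the strip allowed) with `lev k₀ = 0` and `lev k_n = 2T − 1`, and let `P` be a lattice walk all of whose
vertices lie in the levels `0 … 2T−1` and avoid the vertices of `K`, from `p₀` with `xi p₀ ≤ xi k` for all `k ∈ K` to `p₁`
with `xi k ≤ xi p₁` for all `k ∈ K`.  Then `False`.
Proof (parity, no topology): for a vertex `v` put `w(v) :=` the number of edges of `K` between the levels `lev v` and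
`lev v + 1` whose lower endpoint has a smaller column than `v`, plus `1` if `v` is on the top level and `k_n` has a smaller
column (the dangling exit edge of the curtain).  Then `w(p₀) = 0`, `w(p₁)` is odd (a `±1` walk from `0` to `2T−1` crosses each
intermediate half-level an odd number of times), and `w` has constant parity along `P` (double counting: for adjacent `u, v`
off `K`, `w(u) + w(v) ≡ #{k ∈ K on the level of the upper one and to its left, with multiplicity} · 2`).

Label: lane lemma (elementary planar combinatorics of `ℍ`); nothing here is claimed as new mathematics.  Lane «pcv-sawmu»,
a-p2 g16, 2026-08-24.
-/

noncomputable section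

open Finset List Literature.Probability.LatticeModels Literature.Probability.Percolation

namespace Literature.Probability.RandomPlanarGeometry.SAW

namespace HV

/-! ### Level and column -/

/-- A vertex of `ℍ` is determined by its level and its column `ξ`. [cite: DuminilCopinSmirnov2012, §3 (coordinates of the strip S_T)] -/
theorem eq_of_lev_eq_of_xi_eq {u v : HV} (hl : lev u = lev v) (hx : xi u = xi v) : u = v := by
  obtain ⟨a, b, c⟩ := u
  obtain ⟨a', b', c'⟩ := v
  cases c <;> cases c' <;> simp [xi, bit] at hl hx ⊢ <;> omega

/-- Two vertices on the same level have columns of the same parity. [cite: DuminilCopinSmirnov2012, §3 (coordinates of the strip S_T)] -/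
theorem exists_xi_sub_xi_eq_two_mul_of_lev_eq {u v : HV} (hl : lev u = lev v) : ∃ m : ℤ, xi u - xi v = 2 * m := by
  obtain ⟨a, b, c⟩ := u
  obtain ⟨a', b', c'⟩ := v
  cases c <;> cases c' <;> simp [xi, bit] at hl ⊢
  · exact ⟨a - a', by omega⟩
  · omega
  · omega
  · exact ⟨a - a', by omega⟩

/-- Along an edge the column changes by at most one. [cite: Beaton2014RotatedHoneycomb, §2 (Fig. 1(b))] -/
theorem abs_xi_sub_xi_le_one_of_adj {u v : HV} (h : hvGraph.Adj u v) : xi v - xi u ≤ 1 ∧ xi u - xi v ≤ 1 := by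
  rcases xi_adj h with h1 | h1 | h1 <;> constructor <;> omega

/-- **"Left of" is level-independent along parallel edges.**  If `{p, q}` and `{u, v}` are edges with `lev p = lev u`,
`lev q = lev v`, `p ≠ u`, `q ≠ v`, then `xi p < xi u ↔ xi q < xi v`. [cite: DuminilCopinSmirnov2012, §3 (the strip S_T); lane lemma «CURTAIN» (MATHS-NOTE-k1-renewal [J])] -/
theorem xi_lt_xi_iff_of_adj {p q u v : HV} (hpq : hvGraph.Adj p q) (huv : hvGraph.Adj u v) (hpu : lev p = lev u)
    (hqv : lev q = lev v) (hne : p ≠ u) (hne' : q ≠ v) : xi p < xi u ↔ xi q < xi v := by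
  obtain ⟨m, hm⟩ := exists_xi_sub_xi_eq_two_mul_of_lev_eq hpu
  obtain ⟨m', hm'⟩ := exists_xi_sub_xi_eq_two_mul_of_lev_eq hqv
  have h1 : xi p ≠ xi u := fun h => hne (eq_of_lev_eq_of_xi_eq hpu h)
  have h2 : xi q ≠ xi v := fun h => hne' (eq_of_lev_eq_of_xi_eq hqv h)
  have h3 := abs_xi_sub_xi_le_one_of_adj hpq
  have h4 := abs_xi_sub_xi_le_one_of_adj huv
  have hm0 : m ≠ 0 := by rintro rfl; exact h1 (by omega)
  have hm0' : m' ≠ 0 := by rintro rfl; exact h2 (by omega)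
  constructor <;> intro h <;> omega

/-! ### The crossing potential -/

/-- The edges of a walk `K`, as the list of its consecutive pairs (plumbing). [folklore] -/
def curtainEdges (K : List HV) : List (HV × HV) := K.zip K.tail

/-- The edges of `k :: b :: rest` are `(k, b)` and the edges of `b :: rest`. [folklore] -/
@[simp] private theorem curtainEdges_cons_cons (k b : HV) (rest : List HV) :
    curtainEdges (k :: b :: rest) = (k, b) :: curtainEdges (b :: rest) := rfl

/-- A one-vertex walk has no edges. [folklore] -/
@[simp] private theorem curtainEdges_singleton (k : HV) : curtainEdges [k] = [] := rfl

/-- The edge-crossing predicate at a vertex `v`: the edge lies between the levels `lev v` and `lev v + 1` and its endpoint on the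
level of `v` is strictly to the left of `v` (plumbing for the potential). [cite: DuminilCopinSmirnov2012, §3 (levels and columns of the strip S_T); lane plumbing (MATHS-NOTE-k1-renewal [J])] -/
def CurtainCrossesLeft (v : HV) (e : HV × HV) : Prop :=
  (lev e.1 = lev v ∧ lev e.2 = lev v + 1 ∧ xi e.1 < xi v) ∨ (lev e.2 = lev v ∧ lev e.1 = lev v + 1 ∧ xi e.2 < xi v)

/-- The crossing predicate is decidable (plumbing). [folklore] -/
instance (v : HV) (e : HV × HV) : Decidable (CurtainCrossesLeft v e) := by unfold CurtainCrossesLeft; infer_instance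

/-- The crossing potential `w_K(v)` of the curtain `K` at the vertex `v` (width `T`): the number of edges of `K` crossing the
half-level above `v` to the left of `v`, plus one for the dangling exit edge above the last vertex of `K` when `v` is on the top
level `2T − 1` and that last vertex is to the left of `v` (plumbing). [folklore] -/
def curtainPot (T : ℕ) (K : List HV) (v : HV) : ℕ :=
  (curtainEdges K).countP (fun e => decide (CurtainCrossesLeft v e)) +
    if lev v = 2 * (T : ℤ) - 1 ∧ (∃ h : K ≠ [], xi (K.getLast h) < xi v) then 1 else 0

/-- "Inside" indicator used in the double counting: `k` is on the level of `v` and strictly to its left (plumbing). [cite: DuminilCopinSmirnov2012, §3 (levels and columns of the strip S_T); lane plumbing (MATHS-NOTE-k1-renewal [J])] -/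
def CurtainInsLeft (v k : HV) : Prop := lev k = lev v ∧ xi k < xi v

/-- The inside-left predicate is decidable (plumbing). [folklore] -/
instance (v k : HV) : Decidable (CurtainInsLeft v k) := by unfold CurtainInsLeft; infer_instance

/-- The local double-counting identity: for an edge `{k, b}` avoiding the adjacent pair `u` (lower) and `v` (upper), the
number of times it is counted at `u` plus at `v` equals the number of its endpoints that are inside-left of `v`.
[cite: DuminilCopinSmirnov2012, §3 (the strip S_T); lane lemma «CURTAIN» (MATHS-NOTE-k1-renewal [J])] -/
theorem curtainCrossesLeft_add_eq {u v k b : HV} (huv : hvGraph.Adj u v) (hlv : lev v = lev u + 1)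
    (hkb : hvGraph.Adj k b) (hku : k ≠ u) (hbu : b ≠ u) (hkv : k ≠ v) (hbv : b ≠ v) :
    (if CurtainCrossesLeft u (k, b) then 1 else 0) + (if CurtainCrossesLeft v (k, b) then 1 else 0)
      = (if CurtainInsLeft v k then 1 else 0) + (if CurtainInsLeft v b then 1 else 0 : ℕ) := by
  rcases lev_eq_of_adj hkb with hb | hb
  · -- the edge `(k, b)` goes UP one level
    by_cases hk1 : lev k = lev u
    · have key : xi k < xi u ↔ xi b < xi v := xi_lt_xi_iff_of_adj hkb huv hk1 (by omega) hku hbv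
      have eU : CurtainCrossesLeft u (k, b) ↔ xi k < xi u := by
        unfold CurtainCrossesLeft
        constructor
        · rintro (⟨-, -, h⟩ | ⟨h1, -, -⟩)
          · exact h
          · exfalso; simp only at h1; omega
        · intro h; exact Or.inl ⟨hk1, by simp only; omega, h⟩
      have eV : ¬ CurtainCrossesLeft v (k, b) := by
        unfold CurtainCrossesLeft; rintro (⟨h1, h1', -⟩ | ⟨h1, h1', -⟩) <;> simp only at h1 h1' <;> omega
      have eIk : ¬ CurtainInsLeft v k := by unfold CurtainInsLeft; rintro ⟨h, -⟩; omega
      have eIb : CurtainInsLeft v b ↔ xi b < xi v := by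
        unfold CurtainInsLeft
        exact ⟨fun h => h.2, fun h => ⟨by omega, h⟩⟩
      rw [if_neg eV, if_neg eIk]
      by_cases hx : xi k < xi u
      · rw [if_pos (eU.2 hx), if_pos (eIb.2 (key.1 hx))]
      · rw [if_neg (fun h => hx (eU.1 h)), if_neg (fun h => hx (key.2 (eIb.1 h)))]
    · by_cases hk2 : lev k = lev u + 1
      · have eU : ¬ CurtainCrossesLeft u (k, b) := by
          unfold CurtainCrossesLeft; rintro (⟨h1, h1', -⟩ | ⟨h1, h1', -⟩) <;> simp only at h1 h1' <;> omega
        have eV : CurtainCrossesLeft v (k, b) ↔ xi k < xi v := by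
          unfold CurtainCrossesLeft
          constructor
          · rintro (⟨-, -, h⟩ | ⟨h1, -, -⟩)
            · exact h
            · exfalso; simp only at h1; omega
          · intro h; exact Or.inl ⟨by simp only; omega, by simp only; omega, h⟩
        have eIk : CurtainInsLeft v k ↔ xi k < xi v := by
          unfold CurtainInsLeft; exact ⟨fun h => h.2, fun h => ⟨by omega, h⟩⟩
        have eIb : ¬ CurtainInsLeft v b := by unfold CurtainInsLeft; rintro ⟨h, -⟩; omega
        rw [if_neg eU, if_neg eIb]
        by_cases hx : xi k < xi v
        · rw [if_pos (eV.2 hx), if_pos (eIk.2 hx)]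
        · rw [if_neg (fun h => hx (eV.1 h)), if_neg (fun h => hx (eIk.1 h))]
      · have eU : ¬ CurtainCrossesLeft u (k, b) := by
          unfold CurtainCrossesLeft; rintro (⟨h1, h1', -⟩ | ⟨h1, h1', -⟩) <;> simp only at h1 h1' <;> omega
        have eV : ¬ CurtainCrossesLeft v (k, b) := by
          unfold CurtainCrossesLeft; rintro (⟨h1, h1', -⟩ | ⟨h1, h1', -⟩) <;> simp only at h1 h1' <;> omega
        have eIk : ¬ CurtainInsLeft v k := by unfold CurtainInsLeft; rintro ⟨h, -⟩; omega
        have eIb : ¬ CurtainInsLeft v b := by unfold CurtainInsLeft; rintro ⟨h, -⟩; omega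
        rw [if_neg eU, if_neg eV, if_neg eIk, if_neg eIb]
  · -- the edge `(k, b)` goes DOWN one level
    by_cases hb1 : lev b = lev u
    · have key : xi b < xi u ↔ xi k < xi v := xi_lt_xi_iff_of_adj hkb.symm huv hb1 (by omega) hbu hkv
      have eU : CurtainCrossesLeft u (k, b) ↔ xi b < xi u := by
        unfold CurtainCrossesLeft
        constructor
        · rintro (⟨h1, -, -⟩ | ⟨-, -, h⟩)
          · exfalso; simp only at h1; omega
          · exact h
        · intro h; exact Or.inr ⟨hb1, by simp only; omega, h⟩
      have eV : ¬ CurtainCrossesLeft v (k, b) := by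
        unfold CurtainCrossesLeft; rintro (⟨h1, h1', -⟩ | ⟨h1, h1', -⟩) <;> simp only at h1 h1' <;> omega
      have eIk : CurtainInsLeft v k ↔ xi k < xi v := by
        unfold CurtainInsLeft; exact ⟨fun h => h.2, fun h => ⟨by omega, h⟩⟩
      have eIb : ¬ CurtainInsLeft v b := by unfold CurtainInsLeft; rintro ⟨h, -⟩; omega
      rw [if_neg eV, if_neg eIb]
      by_cases hx : xi b < xi u
      · rw [if_pos (eU.2 hx), if_pos (eIk.2 (key.1 hx))]
      · rw [if_neg (fun h => hx (eU.1 h)), if_neg (fun h => hx (key.2 (eIk.1 h)))]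
    · by_cases hb2 : lev b = lev u + 1
      · have eU : ¬ CurtainCrossesLeft u (k, b) := by
          unfold CurtainCrossesLeft; rintro (⟨h1, h1', -⟩ | ⟨h1, h1', -⟩) <;> simp only at h1 h1' <;> omega
        have eV : CurtainCrossesLeft v (k, b) ↔ xi b < xi v := by
          unfold CurtainCrossesLeft
          constructor
          · rintro (⟨h1, -, -⟩ | ⟨-, -, h⟩)
            · exfalso; simp only at h1; omega
            · exact h
          · intro h; exact Or.inr ⟨by simp only; omega, by simp only; omega, h⟩
        have eIk : ¬ CurtainInsLeft v k := by unfold CurtainInsLeft; rintro ⟨h, -⟩; omega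
        have eIb : CurtainInsLeft v b ↔ xi b < xi v := by
          unfold CurtainInsLeft; exact ⟨fun h => h.2, fun h => ⟨by omega, h⟩⟩
        rw [if_neg eU, if_neg eIk]
        by_cases hx : xi b < xi v
        · rw [if_pos (eV.2 hx), if_pos (eIb.2 hx)]
        · rw [if_neg (fun h => hx (eV.1 h)), if_neg (fun h => hx (eIb.1 h))]
      · have eU : ¬ CurtainCrossesLeft u (k, b) := by
          unfold CurtainCrossesLeft; rintro (⟨h1, h1', -⟩ | ⟨h1, h1', -⟩) <;> simp only at h1 h1' <;> omega
        have eV : ¬ CurtainCrossesLeft v (k, b) := by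
          unfold CurtainCrossesLeft; rintro (⟨h1, h1', -⟩ | ⟨h1, h1', -⟩) <;> simp only at h1 h1' <;> omega
        have eIk : ¬ CurtainInsLeft v k := by unfold CurtainInsLeft; rintro ⟨h, -⟩; omega
        have eIb : ¬ CurtainInsLeft v b := by unfold CurtainInsLeft; rintro ⟨h, -⟩; omega
        rw [if_neg eU, if_neg eV, if_neg eIk, if_neg eIb]

/-- **Constancy of the parity of the potential along a by-passing walk** (the double counting, summed along `K`): for an
adjacent pair `u` (lower), `v` (upper) avoiding the walk `K = k :: rest`,
`countU + countV + [k inside-left of v] + [last inside-left of v]` is even.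
[cite: DuminilCopinSmirnov2012, §3 (the strip S_T); lane lemma «CURTAIN» (MATHS-NOTE-k1-renewal [J])] -/
theorem curtain_even_countP_add (u v : HV) (huv : hvGraph.Adj u v) (hlv : lev v = lev u + 1) :
    ∀ (rest : List HV) (k : HV), List.IsChain hvGraph.Adj (k :: rest) → u ∉ k :: rest → v ∉ k :: rest →
      Even ((curtainEdges (k :: rest)).countP (fun e => decide (CurtainCrossesLeft u e)) +
        (curtainEdges (k :: rest)).countP (fun e => decide (CurtainCrossesLeft v e)) +
        (if CurtainInsLeft v k then 1 else 0) + (if CurtainInsLeft v ((k :: rest).getLast (List.cons_ne_nil k rest)) then 1 else 0)) := by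
  intro rest
  induction rest with
  | nil =>
    intro k _ _ _
    simp only [curtainEdges_singleton, List.countP_nil, List.getLast_singleton, zero_add]
    split_ifs <;> decide
  | cons b rest ih =>
    intro k hchain hu hv
    have hkb : hvGraph.Adj k b := (List.isChain_cons_cons.1 hchain).1
    have hchain' : List.IsChain hvGraph.Adj (b :: rest) := (List.isChain_cons_cons.1 hchain).2
    have hu' : u ∉ b :: rest := fun h => hu (List.mem_cons_of_mem k h)
    have hv' : v ∉ b :: rest := fun h => hv (List.mem_cons_of_mem k h)
    have hku : k ≠ u := fun h => hu (h ▸ List.mem_cons_self ..)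
    have hkv : k ≠ v := fun h => hv (h ▸ List.mem_cons_self ..)
    have hbu : b ≠ u := fun h => hu' (h ▸ List.mem_cons_self ..)
    have hbv : b ≠ v := fun h => hv' (h ▸ List.mem_cons_self ..)
    have hloc := curtainCrossesLeft_add_eq huv hlv hkb hku hbu hkv hbv
    have ih' := ih b hchain' hu' hv'
    have hlast : ((k :: b :: rest).getLast (List.cons_ne_nil k (b :: rest)))
        = (b :: rest).getLast (List.cons_ne_nil b rest) := List.getLast_cons (List.cons_ne_nil b rest)
    rw [curtainEdges_cons_cons, List.countP_cons, List.countP_cons, hlast]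
    -- rearrange and use the local identity
    obtain ⟨m, hm⟩ := ih'
    rw [Nat.even_iff]
    simp only [decide_eq_true_eq] at hm ⊢
    by_cases h1 : CurtainCrossesLeft u (k, b) <;> by_cases h2 : CurtainCrossesLeft v (k, b) <;> by_cases h3 : CurtainInsLeft v k <;>
      by_cases h4 : CurtainInsLeft v b <;>
      by_cases h5 : CurtainInsLeft v ((b :: rest).getLast (List.cons_ne_nil b rest)) <;>
      simp only [h1, h2, h3, h4, h5, if_true, if_false] at hloc hm ⊢ <;> omega

/-- **Crossing parity of a `±1` level walk**: the number of edges of `K = k :: rest` between the levels `λ` and `λ + 1`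
(either orientation) has the parity of `[lev k ≤ λ] + [lev last ≤ λ]`. [cite: DuminilCopinSmirnov2012, §3 (levels in the strip S_T); lane lemma «CURTAIN» (MATHS-NOTE-k1-renewal [J])] -/
theorem curtain_even_countP_levels_add (l0 : ℤ) :
    ∀ (rest : List HV) (k : HV), List.IsChain hvGraph.Adj (k :: rest) →
      Even ((curtainEdges (k :: rest)).countP
          (fun e => decide ((lev e.1 = l0 ∧ lev e.2 = l0 + 1) ∨ (lev e.2 = l0 ∧ lev e.1 = l0 + 1))) +
        (if lev k ≤ l0 then 1 else 0) + (if lev ((k :: rest).getLast (List.cons_ne_nil k rest)) ≤ l0 then 1 else 0)) := by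
  intro rest
  induction rest with
  | nil =>
    intro k _
    simp only [curtainEdges_singleton, List.countP_nil, List.getLast_singleton, zero_add]
    split_ifs <;> decide
  | cons b rest ih =>
    intro k hchain
    have hkb : hvGraph.Adj k b := (List.isChain_cons_cons.1 hchain).1
    have hchain' : List.IsChain hvGraph.Adj (b :: rest) := (List.isChain_cons_cons.1 hchain).2
    have ih' := ih b hchain'
    have hlast : ((k :: b :: rest).getLast (List.cons_ne_nil k (b :: rest)))
        = (b :: rest).getLast (List.cons_ne_nil b rest) := List.getLast_cons (List.cons_ne_nil b rest)
    rw [curtainEdges_cons_cons, List.countP_cons, hlast]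
    obtain ⟨m, hm⟩ := ih'
    have hl := lev_eq_of_adj hkb
    rw [Nat.even_iff]
    simp only [decide_eq_true_eq] at hm ⊢
    split_ifs at hm ⊢ <;> omega

/-- ★ **The curtain lemma.**  A lattice walk `K` from the bottom level `0` to the top level `2T − 1` of the strip cannot be
by-passed inside the strip: there is no lattice walk `P` in the levels `0 … 2T−1`, vertex-disjoint from `K`, from a vertex whose
column is `≤` every column of `K` to a vertex whose column is `≥` every column of `K`.
[cite: DuminilCopinSmirnov2012, §3 (the strip S_T between the mid-edges α and β; planarity of ℍ); lane lemma «CURTAIN» (MATHS-NOTE-k1-renewal [J])] -/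
theorem curtain_lemma {T : ℕ} {K P : List HV} (hK : List.IsChain hvGraph.Adj K) (hKne : K ≠ [])
    (hK0 : lev (K.head hKne) = 0) (hKn : lev (K.getLast hKne) = 2 * (T : ℤ) - 1)
    (hP : List.IsChain hvGraph.Adj P) (hPne : P ≠ [])
    (hPlev : ∀ p ∈ P, 0 ≤ lev p ∧ lev p ≤ 2 * (T : ℤ) - 1) (hdisj : ∀ p ∈ P, p ∉ K)
    (hleft : ∀ k ∈ K, xi (P.head hPne) ≤ xi k) (hright : ∀ k ∈ K, xi k ≤ xi (P.getLast hPne)) : False := by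
  obtain ⟨k, rest, rfl⟩ := List.exists_cons_of_ne_nil hKne
  -- (1) the parity of the potential is constant along `P`
  have hstep : ∀ u v : HV, hvGraph.Adj u v → u ∉ k :: rest → v ∉ k :: rest →
      0 ≤ lev u → lev u ≤ 2 * (T : ℤ) - 1 → 0 ≤ lev v → lev v ≤ 2 * (T : ℤ) - 1 →
      (Even (curtainPot T (k :: rest) u) ↔ Even (curtainPot T (k :: rest) v)) := by
    -- reduce to the case `lev v = lev u + 1`
    suffices h : ∀ u v : HV, hvGraph.Adj u v → u ∉ k :: rest → v ∉ k :: rest → lev v = lev u + 1 →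
        0 ≤ lev u → lev v ≤ 2 * (T : ℤ) - 1 →
        (Even (curtainPot T (k :: rest) u) ↔ Even (curtainPot T (k :: rest) v)) by
      intro u v huv hu hv hu0 hu1 hv0 hv1
      rcases lev_eq_of_adj huv with hl | hl
      · exact h u v huv hu hv hl hu0 hv1
      · exact (h v u huv.symm hv hu (by omega) hv0 hu1).symm
    intro u v huv hu hv hlv hu0 hv1
    have hev := curtain_even_countP_add u v huv hlv rest k hK hu hv
    -- `k` (level 0) is never inside-left of `v` (level ≥ 1)
    have hk_ins : ¬ CurtainInsLeft v k := by
      intro h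
      have : lev k = 0 := by simpa using hK0
      unfold CurtainInsLeft at h
      omega
    -- the dangling term of `u` vanishes (`lev u ≤ 2T - 2`), that of `v` equals `[last inside-left of v]`
    have hu_top : ¬ (lev u = 2 * (T : ℤ) - 1 ∧ ∃ h : k :: rest ≠ [], xi ((k :: rest).getLast h) < xi u) := by
      rintro ⟨h, -⟩; omega
    have hKn' : lev ((k :: rest).getLast (List.cons_ne_nil k rest)) = 2 * (T : ℤ) - 1 := by simpa using hKn
    unfold curtainPot
    rw [if_neg hu_top, if_neg hk_ins] at *
    by_cases hvtop : lev v = 2 * (T : ℤ) - 1 ∧ ∃ h : k :: rest ≠ [], xi ((k :: rest).getLast h) < xi v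
    · have hins : CurtainInsLeft v ((k :: rest).getLast (List.cons_ne_nil k rest)) := by
        obtain ⟨h1, h2, h3⟩ := hvtop
        exact ⟨by omega, h3⟩
      rw [if_pos hvtop]
      rw [if_pos hins] at hev
      simp only [add_zero] at hev ⊢
      obtain ⟨m, hm⟩ := hev
      constructor
      · rintro ⟨a, ha⟩; exact ⟨m - a, by omega⟩
      · rintro ⟨a, ha⟩; exact ⟨m - a, by omega⟩
    · have hins : ¬ CurtainInsLeft v ((k :: rest).getLast (List.cons_ne_nil k rest)) := by
        rintro ⟨h1, h2⟩
        exact hvtop ⟨by omega, List.cons_ne_nil k rest, h2⟩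
      rw [if_neg hvtop]
      rw [if_neg hins] at hev
      simp only [add_zero] at hev ⊢
      obtain ⟨m, hm⟩ := hev
      constructor
      · rintro ⟨a, ha⟩; exact ⟨m - a, by omega⟩
      · rintro ⟨a, ha⟩; exact ⟨m - a, by omega⟩
  -- (2) hence `w(p₀)` and `w(p_last)` have the same parity
  have hconst : ∀ (restP : List HV) (p : HV), List.IsChain hvGraph.Adj (p :: restP) →
      (∀ q ∈ p :: restP, 0 ≤ lev q ∧ lev q ≤ 2 * (T : ℤ) - 1) → (∀ q ∈ p :: restP, q ∉ k :: rest) →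
      (Even (curtainPot T (k :: rest) p) ↔
        Even (curtainPot T (k :: rest) ((p :: restP).getLast (List.cons_ne_nil p restP)))) := by
    intro restP
    induction restP with
    | nil => intro p _ _ _; simp
    | cons q restP ih =>
      intro p hch hlev hdj
      have hpq : hvGraph.Adj p q := (List.isChain_cons_cons.1 hch).1
      have h1 := hstep p q hpq (hdj p (List.mem_cons_self ..)) (hdj q (List.mem_cons_of_mem p (List.mem_cons_self ..)))
        (hlev p (List.mem_cons_self ..)).1 (hlev p (List.mem_cons_self ..)).2
        (hlev q (List.mem_cons_of_mem p (List.mem_cons_self ..))).1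
        (hlev q (List.mem_cons_of_mem p (List.mem_cons_self ..))).2
      have h2 := ih q (List.isChain_cons_cons.1 hch).2 (fun r hr => hlev r (List.mem_cons_of_mem p hr))
        (fun r hr => hdj r (List.mem_cons_of_mem p hr))
      rw [List.getLast_cons (List.cons_ne_nil q restP)]
      exact h1.trans h2
  obtain ⟨p, restP, rfl⟩ := List.exists_cons_of_ne_nil hPne
  have hpar := hconst restP p hP hPlev hdisj
  -- (3) `w(p₀) = 0`
  have hp0 : curtainPot T (k :: rest) p = 0 := by
    unfold curtainPot
    have hleft' : ∀ k' ∈ k :: rest, xi p ≤ xi k' := by simpa using hleft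
    rw [List.countP_eq_zero.2, if_neg]
    · rintro ⟨-, h, hlt⟩
      exact absurd (hleft' _ (List.getLast_mem h)) (not_le.2 hlt)
    · intro e he
      have he1 : e.1 ∈ k :: rest := (List.of_mem_zip he).1
      have he2 : e.2 ∈ k :: rest := List.mem_of_mem_tail (List.of_mem_zip he).2
      have := hleft' _ he1
      have := hleft' _ he2
      simp only [decide_eq_true_eq, CurtainCrossesLeft, not_or, not_and, not_lt]
      exact ⟨fun _ _ => by assumption, fun _ _ => by assumption⟩
  -- (4) `w(p_last)` is odd
  set pl := (p :: restP).getLast (List.cons_ne_nil p restP) with hpl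
  have hpl_mem : pl ∈ p :: restP := List.getLast_mem _
  have hplK : pl ∉ k :: rest := hdisj pl hpl_mem
  have hpl_lev := hPlev pl hpl_mem
  have hright' : ∀ k' ∈ k :: rest, xi k' ≤ xi pl := by simpa [hpl] using hright
  have hodd : ¬ Even (curtainPot T (k :: rest) pl) := by
    -- every edge between the levels `lev pl`, `lev pl + 1` is counted
    have hcount : (curtainEdges (k :: rest)).countP (fun e => decide (CurtainCrossesLeft pl e))
        = (curtainEdges (k :: rest)).countP (fun e => decide ((lev e.1 = lev pl ∧ lev e.2 = lev pl + 1) ∨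
            (lev e.2 = lev pl ∧ lev e.1 = lev pl + 1))) := by
      refine List.countP_congr fun e he => ?_
      have he1 : e.1 ∈ k :: rest := (List.of_mem_zip he).1
      have he2 : e.2 ∈ k :: rest := List.mem_of_mem_tail (List.of_mem_zip he).2
      have hx1 : lev e.1 = lev pl → xi e.1 < xi pl := fun hl =>
        lt_of_le_of_ne (hright' _ he1) fun hx => hplK (eq_of_lev_eq_of_xi_eq hl.symm hx.symm ▸ he1)
      have hx2 : lev e.2 = lev pl → xi e.2 < xi pl := fun hl =>
        lt_of_le_of_ne (hright' _ he2) fun hx => hplK (eq_of_lev_eq_of_xi_eq hl.symm hx.symm ▸ he2)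
      simp only [decide_eq_true_eq]
      unfold CurtainCrossesLeft
      constructor
      · rintro (⟨h1, h2, -⟩ | ⟨h1, h2, -⟩)
        · exact Or.inl ⟨h1, h2⟩
        · exact Or.inr ⟨h1, h2⟩
      · rintro (⟨h1, h2⟩ | ⟨h1, h2⟩)
        · exact Or.inl ⟨h1, h2, hx1 h1⟩
        · exact Or.inr ⟨h1, h2, hx2 h1⟩
    have hpar' := curtain_even_countP_levels_add (lev pl) rest k hK
    have hk0 : lev k ≤ lev pl := by
      have : lev k = 0 := by simpa using hK0
      omega
    have hKn' : lev ((k :: rest).getLast (List.cons_ne_nil k rest)) = 2 * (T : ℤ) - 1 := by simpa using hKn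
    rw [if_pos hk0] at hpar'
    unfold curtainPot
    rw [hcount]
    by_cases htop : lev pl = 2 * (T : ℤ) - 1
    · -- top level: the dangling edge is counted, the level crossings are even
      have hlast_lt : xi ((k :: rest).getLast (List.cons_ne_nil k rest)) < xi pl :=
        lt_of_le_of_ne (hright' _ (List.getLast_mem _)) fun hx =>
          hplK (eq_of_lev_eq_of_xi_eq (hKn'.trans htop.symm) hx ▸ List.getLast_mem _)
      have hdang : (lev pl = 2 * (T : ℤ) - 1 ∧ ∃ h : k :: rest ≠ [], xi ((k :: rest).getLast h) < xi pl) :=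
        ⟨htop, List.cons_ne_nil k rest, hlast_lt⟩
      rw [if_pos hdang]
      rw [if_pos (show lev ((k :: rest).getLast (List.cons_ne_nil k rest)) ≤ lev pl by omega)] at hpar'
      intro h
      obtain ⟨m, hm⟩ := hpar'
      obtain ⟨a, ha⟩ := h
      omega
    · have hdang : ¬ (lev pl = 2 * (T : ℤ) - 1 ∧ ∃ h : k :: rest ≠ [], xi ((k :: rest).getLast h) < xi pl) :=
        fun h => htop h.1
      rw [if_neg hdang]
      rw [if_neg (show ¬ lev ((k :: rest).getLast (List.cons_ne_nil k rest)) ≤ lev pl by omega)] at hpar'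
      intro h
      obtain ⟨m, hm⟩ := hpar'
      obtain ⟨a, ha⟩ := h
      omega
  -- (5) contradiction
  rw [hp0] at hpar
  exact hodd (hpar.1 (by decide))

end HV

end Literature.Probability.RandomPlanarGeometry.SAW

end
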